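import Summits.BirchSwinnertonDyer.Rank1Residual.Additive.CyclotomicThreeRankOneDescentData
import Literature.NumberTheory.EllipticCurves.RegulatorBasisProofs
import Literature.NumberTheory.EllipticCurves.RegulatorProofs
import Literature.NumberTheory.EllipticCurves.MordellWeilTheoremProofs
import HarnessLib

/-!
# Rank `(0,1)` over a quadratic field: Milne's Weil-restriction identity with the REGULATORS
# eliminated (`Reg(V_K) · m² = 2 · Reg(V)`), as an identity of rationals (line V17)

HONEST FRAMING (cell `b2b-bsdres`, run/shared/lean/b2b/bsd-rank1-residual/, verbatim in every
file): the goal of the cell is to DELETE the COMBINATION-SHAPED residual classes of the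
Birch–Swinnerton-Dyer formula for ALL analytic-rank `≤ 1` elliptic curves over `ℚ` — "full BSD
formula for every rank `≤ 1` curve in class `C`" assembled STRICTLY from published theorems — so
that the rank-`≤ 1` remainder becomes exactly the CONSTRUCTION-SHAPED classes, which are TYPED
(missing-input `Prop`s), NOT attempted. This is not "finishing BSD". Seat additive-p4, gen 7
(research route on X3/X4); labels UNCHANGED; nothing is booked here.

Theorems only. The rank-`(0,0)` file `CyclotomicThreeDescentData` reads Milne 1972 (in
Dokchitser–Dokchitser's model-free form, tree fact `Milne1972.bsdQuotient_baseChange_quadratic_anyModel`,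
hypothesis `hWR`) on `V ⊗ K` as an identity of RATIONALS once `Reg = 1` on all three curves. Here
`V(ℚ)` has rank one and its twist `W ≅ V^{(d_K)}` rank zero: the two regulators `Reg(V_K/K)` and
`Reg(V/ℚ)` are heights of generators `Q`, `P₀` with `ι P₀ = m • Q + t`, `m ∣ 2`
(`incl_generator_eq_zsmul_of_quadratic`), and `m² · ⟨Q,Q⟩_K = 2 · ⟨P₀,P₀⟩_ℚ`
(`heightPairing_generator_eq`), so they cancel up to the rational factor `2/m²`:

* `isMordellWeilBasis_const_of_card_eq_one` — re-indexing a one-element Mordell–Weil basis by `Fin 1`;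
* `regulator_eq_heightPairing_of_isMordellWeilBasis_one` — `Reg = ⟨Q,Q⟩` for a one-element basis;
* `card_identity_baseChange_rankZeroOne` — **`2·C(V⊗K)·#Ш(V_K)·#V(ℚ)_tors²·#W(ℚ)² =
  m²·n_V·|u_C|·#Ш(V)·#Ш(W)·∏c(V)·∏c(W)·#V(K)_tors²`** (`n_V ∈ {1,2}` real components, `u_C` the
  scaling of `C`), the rank-`(0,1)` twin of `card_identity_baseChange`.
-/

noncomputable section

open scoped Classical

open WeierstrassCurve WeierstrassCurve.Affine.Point Literature.NumberTheory.EllipticCurves NumberField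

namespace Summit.BirchSwinnertonDyer.Rank1Residual.Additive

/-! ## §1 One-element bases: re-indexing and the regulator -/

section OneElement

variable {F : Type*} [Field F] {E : WeierstrassCurve F}

/-- Re-indexing a Mordell–Weil basis on a one-element index type by `Fin 1`. [folklore] -/
theorem isMordellWeilBasis_const_of_card_eq_one {ι : Type*} [Fintype ι] {B : ι → E.toAffine.Point}
    (hB : IsMordellWeilBasis B) (hι : Fintype.card ι = 1) (k : ι) :
    IsMordellWeilBasis (fun _ : Fin 1 => B k) := by
  have huniq : ∀ i : ι, i = k := fun i ↦ Fintype.card_le_one_iff.mp hι.le i k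
  have hne : (QuotientAddGroup.mk (B k) : mordellWeilModTorsion E) ≠ 0 := by
    have h := hB.1.ne_zero k
    simpa only [Function.comp_apply] using h
  refine ⟨?_, ?_⟩
  · exact (linearIndependent_unique_iff
      (v := (QuotientAddGroup.mk ∘ (fun _ : Fin 1 => B k) : Fin 1 → mordellWeilModTorsion E))).mpr hne
  · have hrange : Set.range (QuotientAddGroup.mk ∘ (fun _ : Fin 1 => B k) :
        Fin 1 → mordellWeilModTorsion E) = Set.range (QuotientAddGroup.mk ∘ B) := by
      ext x
      simp only [Set.mem_range, Function.comp_apply]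
      constructor
      · rintro ⟨_, rfl⟩; exact ⟨k, rfl⟩
      · rintro ⟨i, rfl⟩; exact ⟨0, by rw [huniq i]⟩
    rw [hrange]
    exact hB.2

/-- The regulator of a curve with a one-element Mordell–Weil basis `{Q}` is `⟨Q,Q⟩`.
[cite: SilvermanAEC2009, VIII.9] -/
theorem regulator_eq_heightPairing_of_isMordellWeilBasis_one [NumberField F] [E.IsElliptic]
    {Q : E.toAffine.Point} (hQ : IsMordellWeilBasis (fun _ : Fin 1 => Q)) :
    E.regulator = heightPairing Q Q := by
  rw [← hQ.regulatorOf_eq_regulator, regulatorOf,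
    Matrix.det_eq_elem_of_card_eq_one (by rw [Fintype.card_fin]) (0 : Fin 1), heightPairingMatrix_apply]

end OneElement

/-! ## §2 Milne's identity in rank `(0,1)`, regulators eliminated -/

section OverQuadratic

variable (K : Type) [Field K] [NumberField K]
  (V : WeierstrassCurve ℚ) [V.IsElliptic] [V.IsGloballyMinimal]
  (W : WeierstrassCurve ℚ) [W.IsElliptic] [W.IsGloballyMinimal]

omit [V.IsGloballyMinimal] [W.IsElliptic] [W.IsGloballyMinimal] in
/-- **Milne's identity in rank `(0,1)` as an identity of rationals.** `K` imaginary quadratic,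
`W = C • V^{(d_K)}` globally minimal with `W(ℚ)` FINITE, `{P₀}` a Mordell–Weil basis of `V(ℚ)` and
`{Q}` of `V(K)` with `ι P₀ = m • Q + t` (`t` torsion); Milne's Weil-restriction identity for the model
`V ⊗ K` (`hWR`, the conclusion of `Milne1972.bsdQuotient_baseChange_quadratic_anyModel`). Then
`2 · C(V⊗K) · #Ш(V_K) · #V(ℚ)_tors² · #W(ℚ)² = m² · n_V · |u_C| · #Ш(V) · #Ш(W) · ∏c(V) · ∏c(W) · #V(K)_tors²`:
the periods cancel by `Ω(V)·Ω(V^{(d_K)}) = n_V · Ω(V_K/K)` and `Ω(W) = |u_C|·Ω(V^{(d_K)})`, the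
regulators by `m²·Reg(V_K) = 2·Reg(V)` (`heightPairing_generator_eq`), `Reg(W) = 1`.
[cite: Milne1972ArithmeticAV, §1 Thm. 1 and §2 (through DokchitserDokchitserAnnals2010, §2.1)]
[cite: SilvermanAEC2009, Prop. VIII.5.4(b)] -/
theorem card_identity_baseChange_rankZeroOne [IsTotallyComplex K] (h2 : Module.finrank ℚ K = 2)
    {C : VariableChange ℚ} (hC : C • V.quadraticTwist (NumberField.discr K : ℚ) = W)
    [Finite W.toAffine.Point]
    {P₀ : V.toAffine.Point} (hP₀ : IsMordellWeilBasis (fun _ : Fin 1 => P₀))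
    {Q : (V.baseChange K).toAffine.Point} (hQ : IsMordellWeilBasis (fun _ : Fin 1 => Q))
    {m : ℤ} {t : (V.baseChange K).toAffine.Point} (ht : IsOfFinAddOrder t)
    (hmQ : V.pointToBaseChange K P₀ = m • Q + t)
    (hWR : ((V.baseChange K).shaOrder : ℝ) * (V.baseChange K).regulator * (V.baseChange K).bsdPeriod *
        ((V.baseChange K).modifiedTamagawaProduct : ℝ) / ((V.baseChange K).torsionOrder : ℝ) ^ 2 =
      V.bsdRHS * W.bsdRHS) :
    (2 * (V.baseChange K).modifiedTamagawaProduct * (V.baseChange K).shaOrder *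
        (V.torsionOrder : ℚ) ^ 2 * (Nat.card W.toAffine.Point : ℚ) ^ 2 : ℚ) =
      (m : ℚ) ^ 2 * (V.baseChange ℝ).numRealComponents * |(C.u : ℚ)| * V.shaOrder * W.shaOrder *
        V.tamagawaProduct * W.tamagawaProduct * ((V.baseChange K).torsionOrder : ℚ) ^ 2 := by
  have hP : 0 < (V.baseChange K).bsdPeriod := bsdPeriod_pos' _
  have hΩW : W.realPeriodRat = |((C.u : ℚ) : ℝ)| * (V.quadraticTwist (NumberField.discr K : ℚ)).realPeriodRat := by
    rw [← hC]
    exact (V.quadraticTwist (NumberField.discr K : ℚ)).realPeriodRat_smul_holds C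
  have hA : V.realPeriodRat * (V.quadraticTwist (NumberField.discr K : ℚ)).realPeriodRat =
      ((V.baseChange ℝ).numRealComponents : ℝ) * (V.baseChange K).bsdPeriod :=
    realPeriod_mul_realPeriod_quadraticTwist_eq_mul_bsdPeriod V K h2
  -- the regulators
  have hRK : (V.baseChange K).regulator = heightPairing Q Q :=
    regulator_eq_heightPairing_of_isMordellWeilBasis_one hQ
  have hRV : V.regulator = heightPairing P₀ P₀ := regulator_eq_heightPairing_of_isMordellWeilBasis_one hP₀
  have hRVpos : 0 < V.regulator := regulator_pos_holds V
  have hreg : (m : ℝ) ^ 2 * (V.baseChange K).regulator = 2 * V.regulator := by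
    rw [hRK, hRV]
    exact heightPairing_generator_eq K V h2 ht hmQ
  rw [W.bsdRHS_eq_of_finite, bsdRHS_def, hΩW] at hWR
  have hNK : ((V.baseChange K).torsionOrder : ℝ) ≠ 0 := by
    exact_mod_cast ((V.baseChange K).torsionOrder_pos (V.baseChange K).finite_torsion_holds).ne'
  have hNV : (V.torsionOrder : ℝ) ≠ 0 := by exact_mod_cast (V.torsionOrder_pos V.finite_torsion_holds).ne'
  have hNW : (Nat.card W.toAffine.Point : ℝ) ≠ 0 := by
    exact_mod_cast (Nat.card_pos (α := W.toAffine.Point)).ne'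
  -- clear denominators in `ℝ`
  have hWR' : ((V.baseChange K).shaOrder : ℝ) * (V.baseChange K).regulator * (V.baseChange K).bsdPeriod *
        ((V.baseChange K).modifiedTamagawaProduct : ℝ) *
        ((V.torsionOrder : ℝ) ^ 2 * (Nat.card W.toAffine.Point : ℝ) ^ 2) =
      (V.shaOrder : ℝ) * V.regulator * V.realPeriodRat * (V.tamagawaProduct : ℝ) *
        ((W.shaOrder : ℝ) * (|((C.u : ℚ) : ℝ)| *
          (V.quadraticTwist (NumberField.discr K : ℚ)).realPeriodRat) * (W.tamagawaProduct : ℝ)) *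
        ((V.baseChange K).torsionOrder : ℝ) ^ 2 := by
    have h := hWR
    field_simp at h
    linear_combination h
  -- multiply by `m²`, substitute `m² Reg_K = 2 Reg(V)` and `Ω(V)Ω(V^{(d)}) = n P`, cancel `Reg(V) · P`
  have key : ((2 : ℝ) * ((V.baseChange K).modifiedTamagawaProduct : ℝ) * ((V.baseChange K).shaOrder : ℝ) *
        (V.torsionOrder : ℝ) ^ 2 * (Nat.card W.toAffine.Point : ℝ) ^ 2) *
        (V.regulator * (V.baseChange K).bsdPeriod) =
      (((m : ℝ) ^ 2 * ((V.baseChange ℝ).numRealComponents : ℝ) * |((C.u : ℚ) : ℝ)| * (V.shaOrder : ℝ) *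
        (W.shaOrder : ℝ) * (V.tamagawaProduct : ℝ) * (W.tamagawaProduct : ℝ) *
        ((V.baseChange K).torsionOrder : ℝ) ^ 2)) * (V.regulator * (V.baseChange K).bsdPeriod) := by
    linear_combination ((m : ℝ) ^ 2) * hWR'
      - (((V.baseChange K).modifiedTamagawaProduct : ℝ) * ((V.baseChange K).shaOrder : ℝ) *
          (V.torsionOrder : ℝ) ^ 2 * (Nat.card W.toAffine.Point : ℝ) ^ 2 * (V.baseChange K).bsdPeriod) * hreg
      + ((m : ℝ) ^ 2 * |((C.u : ℚ) : ℝ)| * (V.shaOrder : ℝ) * (W.shaOrder : ℝ) * V.regulator *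
          (V.tamagawaProduct : ℝ) * (W.tamagawaProduct : ℝ) * ((V.baseChange K).torsionOrder : ℝ) ^ 2) * hA
  have key' := mul_right_cancel₀ (mul_ne_zero hRVpos.ne' hP.ne') key
  exact_mod_cast key'

end OverQuadratic

end Summit.BirchSwinnertonDyer.Rank1Residual.Additive

end
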